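import Summits.QuantumFields.YangMills.Theorems.ColdStartUniversalityColdStartSolutionsExistQuaternion
import HarnessLib

/-!
# Route `ColdStartUniversality`, support item S (stmt-QuantumFields-24811), line `piwiener`:
# quaternion coordinates on `V = span_ℝ SU(2) ⊂ M₂(ℂ)`

Helper file (lead `ym-line-csu-p1`) for stub A `stub_ambientStrongExistence`: the vector Picard theorem
(`…VecPicard.exists_vecSDE_solution`) is run in REAL coordinates `(a, b, c, d) ∈ ℝ⁴` per link of the
quaternion 4-plane `V = span_ℝ SU(2) = {[[a+bi, c+di], [−c+di, a−bi]]}`, so that the ambient solution is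
`V`-valued surely.  This file is the (definition-free) dictionary: the quaternion matrix
`q(a,b,c,d) = !![a + b i, c + d i; −c + d i, a − b i]` written out explicitly,

* `quat_mem_span` — `q(a,b,c,d) ∈ V` (it is `a·1 + b·I + c·J + d·K` with `I, J, K ∈ SU(2)`);
* `quat_eq_of_mem_span` — every `M ∈ V` is `q(Re M₀₀, Im M₀₀, Re M₀₁, Im M₀₁)`;
  `re_im_of_mem_span` — the entries `M₁₀, M₁₁` of `M ∈ V` in terms of `M₀₀, M₀₁`;
* `hsForm_quat` — `‖q(a,b,c,d)‖_F² = 2(a² + b² + c² + d²)`; `quat_sub` — `q` is additive;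
  `sq_re_im_le_hsForm` — `Re M₀₀² + Im M₀₀² + Re M₀₁² + Im M₀₁² ≤ ‖M‖_F²` for every `M`.

No definition, no sorry.  RECORD-rung plumbing; nothing here bears on the Yang–Mills mass gap. -/

set_option autoImplicit false

noncomputable section

namespace Summit.QuantumFields.YangMills.Theorems.ColdStartUniversality

open Matrix Complex Finset
open scoped ComplexConjugate BigOperators
open Literature.MathematicalPhysics.QuantumFieldTheory
open Literature.MathematicalPhysics.QuantumLattice (fundamentalRep)

/-- The three quaternion units `I = diag(i, −i)`, `J = [[0,1],[−1,0]]`, `K = [[0,i],[i,0]]` and `1` are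
special unitary, hence in the range of the fundamental representation. [folklore] -/
theorem quat_units_mem_range :
    (!![(1 : ℂ), 0; 0, 1] : Matrix (Fin 2) (Fin 2) ℂ) ∈ Set.range ⇑(fundamentalRep (Fin 2)) ∧
    (!![Complex.I, 0; 0, -Complex.I] : Matrix (Fin 2) (Fin 2) ℂ) ∈ Set.range ⇑(fundamentalRep (Fin 2)) ∧
    (!![(0 : ℂ), 1; -1, 0] : Matrix (Fin 2) (Fin 2) ℂ) ∈ Set.range ⇑(fundamentalRep (Fin 2)) ∧
    (!![(0 : ℂ), Complex.I; Complex.I, 0] : Matrix (Fin 2) (Fin 2) ℂ) ∈ Set.range ⇑(fundamentalRep (Fin 2)) := by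
  have key : ∀ M : Matrix (Fin 2) (Fin 2) ℂ, M 1 1 = conj (M 0 0) → M 1 0 = -conj (M 0 1) →
      hsForm 2 M M = 2 → M ∈ Set.range ⇑(fundamentalRep (Fin 2)) := fun M h11 h10 h2 =>
    ⟨⟨M, mem_specialUnitaryGroup_of_quaternion h11 h10 h2⟩, rfl⟩
  refine ⟨key _ (by simp) (by simp) ?_, key _ (by simp) (by simp) ?_, key _ (by simp) (by simp) ?_,
    key _ (by simp) (by simp) ?_⟩ <;> (rw [hsForm_self]; norm_num [Fin.sum_univ_two])

/-- **Quaternion matrices lie in `V = span_ℝ SU(2)`**: `!![a + b i, c + d i; −c + d i, a − b i] ∈ V`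
(`= a·1 + b·I + c·J + d·K`). [folklore] -/
theorem quat_mem_span (a b c d : ℝ) :
    (!![(a : ℂ) + (b : ℂ) * Complex.I, (c : ℂ) + (d : ℂ) * Complex.I;
        -(c : ℂ) + (d : ℂ) * Complex.I, (a : ℂ) - (b : ℂ) * Complex.I] : Matrix (Fin 2) (Fin 2) ℂ) ∈
      Submodule.span ℝ (Set.range ⇑(fundamentalRep (Fin 2))) := by
  obtain ⟨h1, hI, hJ, hK⟩ := quat_units_mem_range
  have hdec : (!![(a : ℂ) + (b : ℂ) * Complex.I, (c : ℂ) + (d : ℂ) * Complex.I;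
        -(c : ℂ) + (d : ℂ) * Complex.I, (a : ℂ) - (b : ℂ) * Complex.I] : Matrix (Fin 2) (Fin 2) ℂ) =
      a • (!![(1 : ℂ), 0; 0, 1] : Matrix (Fin 2) (Fin 2) ℂ) + b • !![Complex.I, 0; 0, -Complex.I] +
        c • !![(0 : ℂ), 1; -1, 0] + d • !![(0 : ℂ), Complex.I; Complex.I, 0] := by
    ext i j
    fin_cases i <;> fin_cases j
    · simp [Complex.real_smul]
    · simp [Complex.real_smul]
    · simp [Complex.real_smul]
    · simp [Complex.real_smul, sub_eq_add_neg]
  rw [hdec]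
  refine Submodule.add_mem _ (Submodule.add_mem _ (Submodule.add_mem _ ?_ ?_) ?_) ?_ <;>
    exact Submodule.smul_mem _ _ (Submodule.subset_span ‹_›)

/-- **Entries of `M ∈ V` are determined by `M₀₀, M₀₁`**: `Re M₁₀ = −Re M₀₁`, `Im M₁₀ = Im M₀₁`,
`Re M₁₁ = Re M₀₀`, `Im M₁₁ = −Im M₀₀`. [folklore] -/
theorem re_im_of_mem_span {M : Matrix (Fin 2) (Fin 2) ℂ}
    (hM : M ∈ Submodule.span ℝ (Set.range ⇑(fundamentalRep (Fin 2)))) :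
    (M 1 0).re = -(M 0 1).re ∧ (M 1 0).im = (M 0 1).im ∧ (M 1 1).re = (M 0 0).re ∧ (M 1 1).im = -(M 0 0).im := by
  obtain ⟨h11, h10⟩ := span_fundamentalRep_le_quaternion hM
  refine ⟨?_, ?_, ?_, ?_⟩
  · rw [h10]; simp
  · rw [h10]; simp
  · rw [h11]; simp
  · rw [h11]; simp

/-- **Every `M ∈ V` is the quaternion matrix of its coordinates** `(Re M₀₀, Im M₀₀, Re M₀₁, Im M₀₁)`.
[folklore] -/
theorem quat_eq_of_mem_span {M : Matrix (Fin 2) (Fin 2) ℂ}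
    (hM : M ∈ Submodule.span ℝ (Set.range ⇑(fundamentalRep (Fin 2)))) :
    (!![((M 0 0).re : ℂ) + ((M 0 0).im : ℂ) * Complex.I, ((M 0 1).re : ℂ) + ((M 0 1).im : ℂ) * Complex.I;
        -((M 0 1).re : ℂ) + ((M 0 1).im : ℂ) * Complex.I, ((M 0 0).re : ℂ) - ((M 0 0).im : ℂ) * Complex.I] :
        Matrix (Fin 2) (Fin 2) ℂ) = M := by
  obtain ⟨h11, h10⟩ := span_fundamentalRep_le_quaternion hM
  ext i j
  fin_cases i <;> fin_cases j
  · simp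
  · simp
  · simp [Complex.ext_iff, h10]
  · simp [Complex.ext_iff, h11]

/-- **`‖q(a,b,c,d)‖_F² = 2(a² + b² + c² + d²)`** for the quaternion matrix. [folklore] -/
theorem hsForm_quat (a b c d : ℝ) :
    hsForm 2 (!![(a : ℂ) + (b : ℂ) * Complex.I, (c : ℂ) + (d : ℂ) * Complex.I;
        -(c : ℂ) + (d : ℂ) * Complex.I, (a : ℂ) - (b : ℂ) * Complex.I] : Matrix (Fin 2) (Fin 2) ℂ)
      (!![(a : ℂ) + (b : ℂ) * Complex.I, (c : ℂ) + (d : ℂ) * Complex.I;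
        -(c : ℂ) + (d : ℂ) * Complex.I, (a : ℂ) - (b : ℂ) * Complex.I]) = 2 * (a ^ 2 + b ^ 2 + c ^ 2 + d ^ 2) := by
  rw [hsForm_self]
  simp [Fin.sum_univ_two, Complex.sq_norm, Complex.normSq_apply]
  ring

/-- The quaternion matrix is additive in its coordinates (difference form). [folklore] -/
theorem quat_sub (a b c d a' b' c' d' : ℝ) :
    (!![(a : ℂ) + (b : ℂ) * Complex.I, (c : ℂ) + (d : ℂ) * Complex.I;
        -(c : ℂ) + (d : ℂ) * Complex.I, (a : ℂ) - (b : ℂ) * Complex.I] : Matrix (Fin 2) (Fin 2) ℂ) -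
      !![(a' : ℂ) + (b' : ℂ) * Complex.I, (c' : ℂ) + (d' : ℂ) * Complex.I;
        -(c' : ℂ) + (d' : ℂ) * Complex.I, (a' : ℂ) - (b' : ℂ) * Complex.I] =
      !![((a - a' : ℝ) : ℂ) + ((b - b' : ℝ) : ℂ) * Complex.I, ((c - c' : ℝ) : ℂ) + ((d - d' : ℝ) : ℂ) * Complex.I;
        -((c - c' : ℝ) : ℂ) + ((d - d' : ℝ) : ℂ) * Complex.I, ((a - a' : ℝ) : ℂ) - ((b - b' : ℝ) : ℂ) * Complex.I] := by
  ext i j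
  fin_cases i <;> fin_cases j <;> simp <;> ring

/-- **`Re M₀₀² + Im M₀₀² + Re M₀₁² + Im M₀₁² ≤ ‖M‖_F²`** for every `M ∈ M₂(ℂ)`. [folklore] -/
theorem sq_re_im_le_hsForm (M : Matrix (Fin 2) (Fin 2) ℂ) :
    (M 0 0).re ^ 2 + (M 0 0).im ^ 2 + (M 0 1).re ^ 2 + (M 0 1).im ^ 2 ≤ hsForm 2 M M := by
  rw [hsForm_self]
  simp only [Fin.sum_univ_two, Complex.sq_norm, Complex.normSq_apply]
  nlinarith [mul_self_nonneg (M 1 0).re, mul_self_nonneg (M 1 0).im, mul_self_nonneg (M 1 1).re,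
    mul_self_nonneg (M 1 1).im]

/-- The real and imaginary parts of the entries of the quaternion matrix. [folklore] -/
theorem quat_entries (a b c d : ℝ) :
    ((!![(a : ℂ) + (b : ℂ) * Complex.I, (c : ℂ) + (d : ℂ) * Complex.I;
        -(c : ℂ) + (d : ℂ) * Complex.I, (a : ℂ) - (b : ℂ) * Complex.I] : Matrix (Fin 2) (Fin 2) ℂ) 0 0).re = a ∧
    ((!![(a : ℂ) + (b : ℂ) * Complex.I, (c : ℂ) + (d : ℂ) * Complex.I;
        -(c : ℂ) + (d : ℂ) * Complex.I, (a : ℂ) - (b : ℂ) * Complex.I] : Matrix (Fin 2) (Fin 2) ℂ) 0 0).im = b ∧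
    ((!![(a : ℂ) + (b : ℂ) * Complex.I, (c : ℂ) + (d : ℂ) * Complex.I;
        -(c : ℂ) + (d : ℂ) * Complex.I, (a : ℂ) - (b : ℂ) * Complex.I] : Matrix (Fin 2) (Fin 2) ℂ) 0 1).re = c ∧
    ((!![(a : ℂ) + (b : ℂ) * Complex.I, (c : ℂ) + (d : ℂ) * Complex.I;
        -(c : ℂ) + (d : ℂ) * Complex.I, (a : ℂ) - (b : ℂ) * Complex.I] : Matrix (Fin 2) (Fin 2) ℂ) 0 1).im = d ∧
    ((!![(a : ℂ) + (b : ℂ) * Complex.I, (c : ℂ) + (d : ℂ) * Complex.I;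
        -(c : ℂ) + (d : ℂ) * Complex.I, (a : ℂ) - (b : ℂ) * Complex.I] : Matrix (Fin 2) (Fin 2) ℂ) 1 0).re = -c ∧
    ((!![(a : ℂ) + (b : ℂ) * Complex.I, (c : ℂ) + (d : ℂ) * Complex.I;
        -(c : ℂ) + (d : ℂ) * Complex.I, (a : ℂ) - (b : ℂ) * Complex.I] : Matrix (Fin 2) (Fin 2) ℂ) 1 0).im = d ∧
    ((!![(a : ℂ) + (b : ℂ) * Complex.I, (c : ℂ) + (d : ℂ) * Complex.I;
        -(c : ℂ) + (d : ℂ) * Complex.I, (a : ℂ) - (b : ℂ) * Complex.I] : Matrix (Fin 2) (Fin 2) ℂ) 1 1).re = a ∧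
    ((!![(a : ℂ) + (b : ℂ) * Complex.I, (c : ℂ) + (d : ℂ) * Complex.I;
        -(c : ℂ) + (d : ℂ) * Complex.I, (a : ℂ) - (b : ℂ) * Complex.I] : Matrix (Fin 2) (Fin 2) ℂ) 1 1).im = -b := by
  simp

end Summit.QuantumFields.YangMills.Theorems.ColdStartUniversality

end
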